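import Summits.RiemannHypothesis.RiemannHypothesis.Theses.MayerPairing

/-!
# Disproof work file for `UnitCircleCrossedOnce` (stmt-RiemannHypothesis-1470, route MayerPairing)

Standing adversary: refuter-cdisprove-stmt-RiemannHypothesis-1470-0, continued by the g2 seat
refuter-cdisprove-stmt-RiemannHypothesis-1470-g2-0 (2026-08-15, file-refutation task).  Findings (numbers, not adjectives):

* **Predicate audit.** The inlined eigenvalue predicate (`IsMayerEigenvalue` below) is *exactly* the
  nonzero point spectrum of Mayer's continued operator `L_s` on `B(D)`, `D = {|z-1| < 3/2}`
  (c := μ f − L_s f is 1-periodic, entire, → 0 along ℝ, hence 0; μ = 0 is excluded by the identity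
  theorem; principal `cpow` is Mayer's branch).  No junk kill: `δ` is existential, so the junk value
  `1/0 = 0` at `z = -1` never bites.  `ucc_iff` records the unfolding.
* **Load-bearing hypotheses (section A).**  Dropping the non-vanishing clause (`f ≢ 0` on `Re z > 0`)
  or the positivity `0 < δ` makes the crux FALSE by junk witnesses (`f ≡ 0`, resp. `δ = -1` and
  `f = indicator {1}`): theorems `ucc_false_without_nonvanishing`, `ucc_false_without_delta_pos`.
  Dropping the NORMALISATION clause (`μ f(x) − f(0)(x+1)^{1−2s}/(2s−1) → 0`) also makes it FALSE, by a
  NON-junk witness (g2 seat, 2026-08-15): the explicit family `f_s(z) = 1 − (z+1)^{−2s}` solves the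
  three-term equation with `μ = −1` for EVERY `s` (`three_term_trivial_solution`; it is Lewis–Zagier's
  trivial period-like function `1 − z^{−2s}` shifted by one, i.e. `c := μf − L_s f ≡ −1 ≠ 0`), so the
  constant unimodular selection `Λ ≡ −1` is admissible: `ucc_false_without_tendsto`.  Hence all four
  conjuncts of the inlined predicate are load-bearing, and the general solution of the bare three-term
  equation is `f = (μ − L_s)⁻¹ c`, `c` any 1-periodic function — the normalisation is what pins `c = 0`.
  The height restriction `7 ≤ |τ|` cannot be attacked in Lean (needs spectral asymptotics at the
  poles s = 0, 1/2 of `L_s`); it is irrelevant to the numerical attack below, which lives at τ ≈ 28–30.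
* **Natural strengthening REFUTED numerically (section B).**  `StrictModulusMonotonicity` (every
  eigenvalue branch has strictly σ-decreasing modulus on (0,1/2) — the stronger regularity that the
  K1 job j000036 observed at 12 heights τ ≤ 18 and recorded on the item) implies the crux
  (`ucc_of_strictModulusMonotonicity`) but is FALSE: with a new, validated discretisation
  (Chebyshev collocation of `L_s` on the invariant interval [-1/4, 3/2]; GKW spectrum at s = 1 to
  1e-10, eigenvalue 1 at ρ₁/2 to 1e-15, ∓1 at the odd/even Maass points 1/2 + i·9.5337 / 13.7798 to
  1e-14; resolution M = 80 vs 120 identical to 4 digits) one finds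
  - at τ = 28.00 a branch with |λ| RISING from 0.6636 (σ = 0.0025) to 0.8870 (σ = 0.3875), then
    falling to 0.8222 (σ = 0.4975) — 155 increasing steps of 199;
  - an exceptional point (square-root branch point of two coalescing eigenvalues) at
    s_EP = 0.35349 + 28.04162 i with λ_EP = 0.38900 + 0.86800 i, |λ_EP| = 0.95118, |C| = 0.912
    (λ± ≈ λ_EP ± C √(s − s_EP)), located by Newton's method on the discriminant (μ₁ − μ₂)²;
  - a second EP at s_EP = 0.01858 + 29.78740 i, |λ_EP| = 1.7179, |C| = 1.920, near which one
    branch's modulus rises 1.5303 → 1.7179 over σ ∈ [0.0025, 0.019] (τ = 29.7874) — bump 0.10 at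
    τ = 29.78 / 29.795, 0.02–0.03 at ±0.035, monotone again at ±0.085.
  Mechanism: away from EPs the eigenvalues move almost radially inward in σ
  (d log λ/dσ ≈ −κ_k ∈ [−3.4, −0.65], real), so folds of the level set {|λ_k| = 1} — which is what
  ¬UCC needs — can only occur in windows |τ − τ_EP| ≲ 0.05 around EPs whose modulus is within the
  bump height (~|C|²/(2κ|λ|), here 5–40 %) of 1.  The number of significant branches grows like
  ~τ/5 (Weyl law for Maass forms: 1 at τ = 7, 3 at 18, 6 at 30), so EPs proliferate with τ; the EP
  at |λ_EP| = 0.951 already sits 5 % from the unit circle.  Why 12-height surveys saw nothing: at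
  τ ≤ 26.5 no branch with |λ| > 0.2 has an increasing step on a 60-point σ grid (checked τ = 14,
  18, 22, 25, 26.5).
* **KILLED (K1 witness, 2026-08-15, EVIDENCE.md on the item; class `refuted-substantive`).**  At τ* = 37.85
  ONE continuous eigenvalue branch σ ↦ λ(σ + iτ*) of `L_s` satisfies
      |λ| = 0.921105 (σ = 0.0005) ↗ 1 at a* = 0.1692965890394 (λ = 0.9161923273286 + 0.4007388418211 i)
      ↗ peak 1.092064 (σ = 0.23415) ↘ 1 at b* = 0.3769592935773 (λ = 0.7979851238805 + 0.6026771457965 i)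
      ↘ 0.887900 (σ = 0.4995),
  so Λ := λ|[a*,b*] is continuous, eigenvalue-valued, ‖Λ a*‖ = ‖Λ b*‖ = 1 (bisection to 5·10⁻¹⁴), 0 < a* < b* < 1/2,
  |τ*| ≥ 7: an instance of `not_ucc_iff`'s right-hand side.  Robustness: identical at M = 89 / 129 (n0 = 125 / 177) and
  on the different invariant interval [−0.3, 1.6] (M = 100, n0 = 250, K = 34); the branch stays ≥ 0.345 from every other
  eigenvalue while consecutive samples differ by ≤ 0.0045 (no branch mixing); the eigenpairs at a*, b* and at the peak are
  verified A POSTERIORI: Λ f = L_s f to 2·10⁻¹¹ and the three-term equation of the predicate,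
  Λ (f z − f (z+1)) = (z+1)^(−2s) f (1/(z+1)), to 5·10⁻¹² at off-grid points.  Open in τ: double crossings for all
  τ ∈ (37.8303, ≈37.94) (τ = 37.90: a ≈ 0.17462, b ≈ 0.33165, peak 1.026).  Cause: the exceptional point
  s_EP = 0.19343 + 37.83032 i, λ_EP = 1.0641 + 0.3405 i (|λ_EP| = 1.117, |C| = 1.22) between a descending branch
  (2.19 → 0.59) and an anomalous flat branch (|λ| ≈ 0.9 across the strip) folds the unit level curve.
  Independent-basis cross-checks (Arb-certified eigenvalues of Mayer's truncated disc matrix, N = 2.6τ+60) = kit jobs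
  j006819 / j006821; full census τ ∈ [7,100] = j006823 (all auto-attach to the item).
* **SECOND, INDEPENDENT WITNESS (prover seat MayerPairing-2, evidence `K1_UnitCircleCrossedTwice_tau24.md` on the
  item, 2026-08-15T23:27Z).**  At τ = 24 (and at the zero height γ₉/2 = 24.0025754, and at 23.95) one continuous branch has
  |λ(0⁺)| = 0.98858 ↗ 1 at a = 0.0229335 ↗ peak 1.4035845 (σ ≈ 0.158) ↘ 1 at b = 0.3612464 ↘ |λ(½)| = 0.76644; two
  discretisations (Taylor centre 1, N = 120 vs centre 3/2, N = 168) agree to 19 digits; N = 88/110 identical.  NOTE γ₉/2 is a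
  ZERO HEIGHT: the repair "UCC only at heights Im ρ/2" (all the deciding theorem `closes` uses) is killed as well.
* **THIRD implementation (this seat, kit jobs j007283 smoke / j007284 full, auto-attach to the item).**  From-scratch
  python-flint/Arb code: exact Hurwitz-zeta Taylor matrices on the two invariant discs (c,R) = (1,3/2) and (3/2,2), approx +
  RIGOROUS (finite-matrix) eigenvalue enclosures, basis-free residuals sup|L_s p − μ p|/sup|p| of the eigenpolynomial against the
  TRUE continued operator ((L_s p)(z) = Σ_j q_j ζ_H(2s+j, z+1) exactly for a polynomial p), fine-grid isolation/jump ratios;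
  re-verifies BOTH witnesses (τ = 24 and τ = 37.85).  Results: see the compute-j007284.json evidence / NOTES of the g2 seat.
* **WHY NO LEAN `¬S` (file-refutation task, g2 seat).**  `¬ UnitCircleCrossedOnce` (shape `not_ucc_iff`) asks for genuine
  eigenfunctions of `L_{σ+iτ}` for EVERY σ of a segment — transcendental objects with no closed form (the only closed-form
  solutions of the three-term equation, `1 − (z+1)^{−2s}` & co., are exactly the NON-eigenfunctions removed by the
  normalisation clause, section A).  A sorry-free proof would need, inside Lean: Mayer's `L_s` on `B(D)` with its nuclearity
  and Fredholm determinant, Grothendieck–Lidskii (existence of eigenvalues), Kato's analytic perturbation theory (continuous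
  branches), and validated numerics of 10²-dimensional Hurwitz-zeta matrices with a 10³³ dynamic range at |Im 2s| ≈ 48–76 plus
  an a-priori truncation bound (Bandtlow–Jenkinson / Nisoli-type).  None exists in Mathlib; this is years of formalisation,
  not a session.  So the kill is, and stays, an EVIDENCE-FILE refutation (`verdict: computation`): no `--kind refutation`
  proposal can be made without `sorry`, and none was filed.  The item should be closed by the planner's own kill
  criterion K1 ("a truncation-stable eigenvalue path meeting |λ| = 1 twice ⇒ close the route"), now met three times over.
* **Repair analysis.**  No side condition is missing: heights recur (EP windows densify with τ), a* < 1/4 < b*, and zero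
  heights are hit (γ₉/2, second witness), symmetric intervals [a, ½−a] are hit by continuity in τ (a+b = 0.546 at τ = 37.85,
  0.506 at 37.90, window closes at ≈ 37.94 with a = b ≈ 0.23: a(τ)+b(τ)−½ changes sign inside the window), and the only
  surviving variant is the endpoint-VALUE form `Λ a = 1 ∧ Λ b = 1 → False`, which is RH-equivalent (Efrat's converse
  dictionary) and was explicitly refused as a crux by the planner (kill criterion K1 ⇒ close the route).  Barrier
  candidate: "σ-monotonicity / single unit-crossing of eigenvalue moduli of Mayer-type transfer-operator families is
  false at large height because exceptional points proliferate (bumps ~|C|²/(2κ|λ|) = O(10 %))".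
-/

set_option linter.dupNamespace false

namespace Summit.RiemannHypothesis.RiemannHypothesis.Cruxes.UnitCircleCrossedOnce.Disproof

open Filter Topology Set
open Summit.RiemannHypothesis.RiemannHypothesis.Theses.MayerPairing

/-- The eigenvalue predicate inlined in every item of the route: "`μ` is an eigenvalue of Mayer's
continued transfer operator `L_s`", in the Lewis–Zagier/Chang–Mayer three-term form. -/
def IsMayerEigenvalue (s μ : ℂ) : Prop :=
  ∃ f : ℂ → ℂ, ∃ δ : ℝ, 0 < δ ∧ DifferentiableOn ℂ f {z : ℂ | -δ < z.re} ∧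
    (∃ z : ℂ, 0 < z.re ∧ f z ≠ 0) ∧
    (∀ z : ℂ, -δ < z.re → μ * (f z - f (z + 1)) = (z + 1) ^ (-(2 * s)) * f (1 / (z + 1))) ∧
    Tendsto (fun x : ℝ => μ * f x - f 0 * ((x : ℂ) + 1) ^ (1 - 2 * s) / (2 * s - 1)) atTop (𝓝 0)

/-- The crux, read through the named predicate (definitional unfolding only). -/
theorem ucc_iff :
    UnitCircleCrossedOnce ↔
      ∀ τ : ℝ, 7 ≤ |τ| → ∀ a b : ℝ, 0 < a → a < b → b < 1 / 2 → ∀ Λ : ℝ → ℂ,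
        ContinuousOn Λ (Icc a b) →
        (∀ σ ∈ Icc a b, IsMayerEigenvalue ((σ : ℂ) + (τ : ℂ) * Complex.I) (Λ σ)) →
        ¬ (‖Λ a‖ = 1 ∧ ‖Λ b‖ = 1) :=
  Iff.rfl

/-! ## A. Load-bearing analysis: hypotheses of the eigenvalue predicate that cannot be dropped -/

/-- The crux with the non-vanishing clause `∃ z, 0 < z.re ∧ f z ≠ 0` deleted from the predicate. -/
def WithoutNonvanishing : Prop :=
  ∀ τ : ℝ, 7 ≤ |τ| → ∀ a b : ℝ, 0 < a → a < b → b < 1 / 2 → ∀ Λ : ℝ → ℂ,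
    ContinuousOn Λ (Icc a b) →
    (∀ σ ∈ Icc a b, ∃ f : ℂ → ℂ, ∃ δ : ℝ, 0 < δ ∧ DifferentiableOn ℂ f {z : ℂ | -δ < z.re} ∧
      (∀ z : ℂ, -δ < z.re → Λ σ * (f z - f (z + 1)) =
        (z + 1) ^ (-(2 * ((σ : ℂ) + (τ : ℂ) * Complex.I))) * f (1 / (z + 1))) ∧
      Tendsto (fun x : ℝ => Λ σ * f x - f 0 * ((x : ℂ) + 1) ^ (1 - 2 * ((σ : ℂ) + (τ : ℂ) * Complex.I)) /
        (2 * ((σ : ℂ) + (τ : ℂ) * Complex.I) - 1)) atTop (𝓝 0)) →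
    ¬ (‖Λ a‖ = 1 ∧ ‖Λ b‖ = 1)

/-- Any proof of the crux must use the non-vanishing clause: without it `f ≡ 0` makes every `μ`
an "eigenvalue", so the constant selection `Λ ≡ 1` on `[1/8, 1/4]` at height `τ = 7` is admissible. -/
theorem ucc_false_without_nonvanishing : ¬ WithoutNonvanishing := by
  intro h
  have h7 : (7 : ℝ) ≤ |(7 : ℝ)| := by norm_num
  refine h 7 h7 (1 / 8) (1 / 4) (by norm_num) (by norm_num) (by norm_num) (fun _ => 1)
    continuousOn_const ?_ ⟨by simp, by simp⟩
  intro σ _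
  refine ⟨fun _ => 0, 1, one_pos, differentiableOn_const 0, ?_, ?_⟩
  · intro z _
    simp
  · simp

/-- The crux with the positivity `0 < δ` of the half-plane parameter deleted. -/
def WithoutDeltaPos : Prop :=
  ∀ τ : ℝ, 7 ≤ |τ| → ∀ a b : ℝ, 0 < a → a < b → b < 1 / 2 → ∀ Λ : ℝ → ℂ,
    ContinuousOn Λ (Icc a b) →
    (∀ σ ∈ Icc a b, ∃ f : ℂ → ℂ, ∃ δ : ℝ, DifferentiableOn ℂ f {z : ℂ | -δ < z.re} ∧
      (∃ z : ℂ, 0 < z.re ∧ f z ≠ 0) ∧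
      (∀ z : ℂ, -δ < z.re → Λ σ * (f z - f (z + 1)) =
        (z + 1) ^ (-(2 * ((σ : ℂ) + (τ : ℂ) * Complex.I))) * f (1 / (z + 1))) ∧
      Tendsto (fun x : ℝ => Λ σ * f x - f 0 * ((x : ℂ) + 1) ^ (1 - 2 * ((σ : ℂ) + (τ : ℂ) * Complex.I)) /
        (2 * ((σ : ℂ) + (τ : ℂ) * Complex.I) - 1)) atTop (𝓝 0)) →
    ¬ (‖Λ a‖ = 1 ∧ ‖Λ b‖ = 1)

/-- Any proof of the crux must use `0 < δ` (the eigenfunction has to be holomorphic on a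
neighbourhood of the CLOSED half-plane `Re z ≥ 0`, in particular at `0`): with `δ = -1` the domain is
`Re z > 1`, which misses the point `1`, its translates `z + 1` and its images `1/(z+1)`
(`|1/(z+1) - 1/4| < 1/4` there); so `f = indicator {1}` is a junk eigenfunction for every `μ`. -/
theorem ucc_false_without_delta_pos : ¬ WithoutDeltaPos := by
  intro h
  have h7 : (7 : ℝ) ≤ |(7 : ℝ)| := by norm_num
  refine h 7 h7 (1 / 8) (1 / 4) (by norm_num) (by norm_num) (by norm_num) (fun _ => 1)
    continuousOn_const ?_ ⟨by simp, by simp⟩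
  intro σ _
  refine ⟨Set.indicator {(1 : ℂ)} (fun _ => (1 : ℂ)), -1, ?_, ⟨1, by simp, by simp⟩, ?_, ?_⟩
  · -- on `Re z > 1` the function vanishes identically
    have hsub : ∀ z ∈ {z : ℂ | -(-1 : ℝ) < z.re}, Set.indicator {(1 : ℂ)} (fun _ => (1 : ℂ)) z = 0 := by
      intro z hz
      have hz' : (1 : ℝ) < z.re := by simpa using hz
      have hne : z ≠ 1 := by
        intro hz1
        rw [hz1, Complex.one_re] at hz'
        exact lt_irrefl _ hz'
      simp [hne]
    exact (differentiableOn_const (0 : ℂ)).congr hsub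
  · intro z hz
    have hz' : (1 : ℝ) < z.re := by simpa using hz
    have hne : z ≠ 1 := by
      intro hz1
      rw [hz1, Complex.one_re] at hz'
      exact lt_irrefl _ hz'
    have hne0 : z ≠ 0 := by
      intro hz0
      rw [hz0, Complex.zero_re] at hz'
      linarith
    have hne1 : z + 1 ≠ 1 := by
      intro h1
      exact hne0 (by linear_combination h1)
    simp [hne, hne1]
  · have h0 : Set.indicator {(1 : ℂ)} (fun _ => (1 : ℂ)) 0 = 0 := by simp
    rw [h0]
    apply tendsto_const_nhds.congr'
    filter_upwards [eventually_gt_atTop (1 : ℝ)] with x hx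
    have hne : (x : ℂ) ≠ 1 := by
      intro hx1
      have : x = 1 := by exact_mod_cast hx1
      linarith
    simp [hne]

section WithoutNormalisation

open Complex

/-- `(z+1)^w · ((z+2)/(z+1))^w = (z+2)^w` on the half-plane `Re z > -1` (principal branches: the
arguments of `z+1` and of `(z+2)/(z+1) = 1 + (z+1)⁻¹` both lie in `(-π/2, π/2)`, so no cut is
crossed).  The one analytic input of the trivial-solution computation below. -/
theorem cpow_mul_cpow_div_eq {z : ℂ} (hz : -1 < z.re) (w : ℂ) :
    (z + 1) ^ w * ((z + 2) / (z + 1)) ^ w = (z + 2) ^ w := by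
  have h1re : 0 < (z + 1).re := by simp; linarith
  have h1 : z + 1 ≠ 0 := fun h => by rw [h] at h1re; simp at h1re
  have h2re : 0 < (z + 2).re := by simp; linarith
  have h2 : z + 2 ≠ 0 := fun h => by rw [h] at h2re; simp at h2re
  set q : ℂ := (z + 2) / (z + 1) with hq
  have hq' : q = 1 + (z + 1)⁻¹ := by rw [hq]; field_simp; ring
  have hqre : 0 < q.re := by
    rw [hq', add_re, one_re, inv_re]
    have : 0 ≤ (z + 1).re / normSq (z + 1) := div_nonneg h1re.le (normSq_nonneg _)
    linarith
  have hq0 : q ≠ 0 := fun h => by rw [h] at hqre; simp at hqre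
  have harg : arg (z + 1) + arg q ∈ Set.Ioc (-Real.pi) Real.pi := by
    have ha := abs_arg_lt_pi_div_two_iff.2 (Or.inl h1re)
    have hb := abs_arg_lt_pi_div_two_iff.2 (Or.inl hqre)
    rw [abs_lt] at ha hb
    constructor <;> linarith [Real.pi_pos]
  have hlog : log ((z + 1) * q) = log (z + 1) + log q := (log_mul_eq_add_log_iff h1 hq0).2 harg
  have hprod : (z + 1) * q = z + 2 := by rw [hq]; field_simp
  rw [cpow_def_of_ne_zero h1, cpow_def_of_ne_zero hq0, cpow_def_of_ne_zero h2, ← Complex.exp_add,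
    ← hprod, hlog]
  ring_nf

/-- **The trivial solution.** `f_s(z) = 1 - (z+1)^{-2s}` solves the three-term equation of the
inlined predicate with `μ = -1`, for EVERY `s ∈ ℂ` and all `Re z > -1` (Lewis–Zagier's period-like
function `ψ(z) = 1 - z^{-2s}`, which satisfies `ψ(z) = ψ(z+1) + (z+1)^{-2s} ψ(z/(z+1))` and
`ψ(z) = -z^{-2s} ψ(1/z)`, shifted: `f = ψ(· + 1)`).  It is NOT an eigenfunction of `L_s`
(`L_s f = (z+1)^{-2s}`, so `μ f - L_s f ≡ -1`): only the normalisation clause of the predicate sees this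
(`f(0) = 0`, `μ f(x) → -1 ≠ 0`). -/
theorem three_term_trivial_solution (s : ℂ) {z : ℂ} (hz : -1 < z.re) :
    (-1 : ℂ) * ((1 - (z + 1) ^ (-(2 * s))) - (1 - (z + 1 + 1) ^ (-(2 * s)))) =
      (z + 1) ^ (-(2 * s)) * (1 - (1 / (z + 1) + 1) ^ (-(2 * s))) := by
  have h1re : 0 < (z + 1).re := by simp; linarith
  have h1 : z + 1 ≠ 0 := fun h => by rw [h] at h1re; simp at h1re
  have hq : 1 / (z + 1) + 1 = (z + 2) / (z + 1) := by field_simp; ring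
  have h2 : z + 1 + 1 = z + 2 := by ring
  rw [hq, h2]
  linear_combination cpow_mul_cpow_div_eq hz (-(2 * s))

/-- The crux with the normalisation clause `μ f(x) - f(0)(x+1)^{1-2s}/(2s-1) → 0` deleted from the
predicate (holomorphy, non-vanishing and the three-term equation kept). -/
def WithoutTendsto : Prop :=
  ∀ τ : ℝ, 7 ≤ |τ| → ∀ a b : ℝ, 0 < a → a < b → b < 1 / 2 → ∀ Λ : ℝ → ℂ,
    ContinuousOn Λ (Icc a b) →
    (∀ σ ∈ Icc a b, ∃ f : ℂ → ℂ, ∃ δ : ℝ, 0 < δ ∧ DifferentiableOn ℂ f {z : ℂ | -δ < z.re} ∧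
      (∃ z : ℂ, 0 < z.re ∧ f z ≠ 0) ∧
      (∀ z : ℂ, -δ < z.re → Λ σ * (f z - f (z + 1)) =
        (z + 1) ^ (-(2 * ((σ : ℂ) + (τ : ℂ) * Complex.I))) * f (1 / (z + 1)))) →
    ¬ (‖Λ a‖ = 1 ∧ ‖Λ b‖ = 1)

/-- Any proof of the crux must use the NORMALISATION clause: without it the constant unimodular
selection `Λ ≡ -1` on `[1/8, 1/4]` at height `τ = 7` is admissible, witnessed by the genuine
(non-junk) holomorphic solutions `f_s(z) = 1 - (z+1)^{-2s}` on `Re z > -1` (`δ = 1`), with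
`f_s(1) = 1 - 2^{-2s} ≠ 0` because `‖2^{-2s}‖ = 2^{-2σ} < 1`.  (So "unit-circle crossed once" is
not a property of the three-term equation; it can only come from the spectral normalisation.) -/
theorem ucc_false_without_tendsto : ¬ WithoutTendsto := by
  intro h
  have h7 : (7 : ℝ) ≤ |(7 : ℝ)| := by norm_num
  refine h 7 h7 (1 / 8) (1 / 4) (by norm_num) (by norm_num) (by norm_num) (fun _ => -1)
    continuousOn_const ?_ ⟨by simp, by simp⟩
  intro σ hσ
  have hσ0 : 0 < σ := by linarith [hσ.1]
  set w : ℂ := -(2 * ((σ : ℂ) + ((7 : ℝ) : ℂ) * Complex.I)) with hw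
  refine ⟨fun z => 1 - (z + 1) ^ w, 1, one_pos, ?_, ⟨1, by simp, ?_⟩, ?_⟩
  · -- holomorphy on `Re z > -1` (`z + 1` stays in the slit plane)
    intro z hz
    have hz' : -1 < z.re := by simpa using hz
    have hslit : z + 1 ∈ slitPlane := Or.inl (by simp; linarith)
    exact (((differentiableAt_id.add_const 1).cpow (differentiableAt_const w) hslit).const_sub
      1).differentiableWithinAt
  · -- `f 1 = 1 - 2^w ≠ 0` because `‖2^w‖ = 2^{-2σ} < 1`
    have h2 : (1 : ℂ) + 1 = ((2 : ℝ) : ℂ) := by norm_num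
    show (1 : ℂ) - (1 + 1) ^ w ≠ 0
    rw [h2, sub_ne_zero]
    intro h1
    have hn : ‖((2 : ℝ) : ℂ) ^ w‖ < 1 := by
      rw [norm_cpow_eq_rpow_re_of_pos (by norm_num : (0 : ℝ) < 2)]
      have hre : w.re = -(2 * σ) := by simp [hw]
      rw [hre]
      exact Real.rpow_lt_one_of_one_lt_of_neg (by norm_num) (by linarith)
    rw [← h1] at hn
    simp at hn
  · intro z hz
    have hz' : -1 < z.re := by simpa using hz
    simpa [hw] using three_term_trivial_solution ((σ : ℂ) + ((7 : ℝ) : ℂ) * Complex.I) hz'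

end WithoutNormalisation

/-! ## B. The natural strengthening "all moduli strictly decreasing" — implies the crux, but is
numerically FALSE (τ ≈ 28.0: a branch rises 0.6636 → 0.8870; τ ≈ 29.79: EP bump 1.53 → 1.72). -/

/-- STRICT σ-MONOTONICITY of eigenvalue moduli along every continuous eigenvalue selection
(the card's original MONOTONICITY; the regularity observed by job j000036 at 12 heights τ ≤ 18).
NUMERICALLY FALSE at τ = 28.00 (session refuter-cdisprove-…-1470-0, Chebyshev-interval kernel,
M = 80 and 120 agree) — see the module docstring; kept here as the statement provers must NOT
try to prove. -/
def StrictModulusMonotonicity : Prop :=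
  ∀ τ : ℝ, 7 ≤ |τ| → ∀ a b : ℝ, 0 < a → a < b → b < 1 / 2 → ∀ Λ : ℝ → ℂ,
    ContinuousOn Λ (Icc a b) →
    (∀ σ ∈ Icc a b, IsMayerEigenvalue ((σ : ℂ) + (τ : ℂ) * Complex.I) (Λ σ)) →
    StrictAntiOn (fun σ => ‖Λ σ‖) (Icc a b)

/-- The strengthening implies the crux (so its numerical failure does not touch the crux, but it
kills the "provable-for-large-τ monotonicity" programme suggested on the item). -/
theorem ucc_of_strictModulusMonotonicity (h : StrictModulusMonotonicity) : UnitCircleCrossedOnce := by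
  rw [ucc_iff]
  intro τ hτ a b ha hab hb Λ hΛ heig ⟨h1, h2⟩
  have hlt := h τ hτ a b ha hab hb Λ hΛ heig (left_mem_Icc.2 hab.le) (right_mem_Icc.2 hab.le) hab
  simp only [h1, h2, lt_self_iff_false] at hlt

/-! ## C. What a kill looks like (target shape for the evidence file)

`¬ UnitCircleCrossedOnce ↔ ∃ τ, 7 ≤ |τ| ∧ ∃ a b, 0 < a ∧ a < b ∧ b < 1/2 ∧ ∃ Λ, ContinuousOn Λ (Icc a b) ∧
  (∀ σ ∈ Icc a b, IsMayerEigenvalue (σ + τ I) (Λ σ)) ∧ ‖Λ a‖ = 1 ∧ ‖Λ b‖ = 1`.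
Numerically: a height τ and ONE tracked branch with |λ| = 1 at σ = a and σ = b (fold of the unit
level curve next to an exceptional point with |λ_EP| ≈ 1).  FOUND: τ = 37.85, a* ≈ 0.16930, b* ≈ 0.37696 (module docstring). -/
theorem not_ucc_iff :
    ¬ UnitCircleCrossedOnce ↔
      ∃ τ : ℝ, 7 ≤ |τ| ∧ ∃ a b : ℝ, 0 < a ∧ a < b ∧ b < 1 / 2 ∧ ∃ Λ : ℝ → ℂ,
        ContinuousOn Λ (Icc a b) ∧
        (∀ σ ∈ Icc a b, IsMayerEigenvalue ((σ : ℂ) + (τ : ℂ) * Complex.I) (Λ σ)) ∧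
        ‖Λ a‖ = 1 ∧ ‖Λ b‖ = 1 := by
  rw [ucc_iff]
  push Not
  constructor
  · rintro ⟨τ, hτ, a, b, ha, hab, hb, Λ, hΛ, he, h1, h2⟩
    exact ⟨τ, hτ, a, b, ha, hab, hb, Λ, hΛ, he, h1, h2⟩
  · rintro ⟨τ, hτ, a, b, ha, hab, hb, Λ, hΛ, he, h1, h2⟩
    exact ⟨τ, hτ, a, b, ha, hab, hb, Λ, hΛ, he, h1, h2⟩

end Summit.RiemannHypothesis.RiemannHypothesis.Cruxes.UnitCircleCrossedOnce.Disproof
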